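import Summits.QuantumFields.YangMills.Theorems.FluctuationComparisonRegPrIntLS2BetaCanonicalCurrency
import Summits.QuantumFields.YangMills.Theorems.FluctuationComparisonRegPrIntLHistoryPartition
import HarnessLib

/-!
# THE WINDOW CUT of [Balaban1985UV3] (40) p.266 ON THE TREE's HISTORY PARTITION: histories that are LARGE AT THE COMPARISON HEIGHT vanish a.e. on the
# window; on `W_n` the full height-`n` density is the sum over the histories with `n + 1` FREE top steps, whose trivial term is the all-small density of LFG

Cell `ym3-torus` (HUMAN RULING D-0037: rung R3 = continuum `SU(2)` Yang–Mills on `T³` — NOT `d = 4`, NOT infinite volume, NOT a mass gap, NOT the Clay problem); width seat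
`ym3-torus-px10` (gen 16); helper of the crux `stmt-QuantumFields-20520` `UnitScaleTilt.FluctuationComparisonRegPrIntL` (`--supports … --as helper`, NOT a proof of it); LOCATE
`LOCATE-LFG-px10g16.md` (20520 evidence #41) row (W); FILE 3 (FILE 1 `…LargeFieldGasCanonicalCurrency`: LFG ⟺ LFG^{can}; FILE 2 `…LargeFieldGasInteriorDoor`: LFG^{can}∘ ⟹
`LargeFieldFourPtIntCan`).  THEOREMS ONLY: 0 `def`, 0 `instance`, 0 `notation`, 0 `sorry`, default heartbeats.

CONTEXT.  LFG^{can} reads, on the window `W_n = {PlaqSmall (θ n)}` at the comparison height `n ≤ K`, the ratio of the canonical versions of `heightDensity F γ hK univ` (the FULL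
transported density of run `K`) and `heightDensity F γ hK (histGood θ K n)` (the ALL-SMALL one).  The tree's history partition (✓`…HistoryPartitionDefs`: labels
`LFLabel F K n = Σ j : Fin (K − n + 1), Plaq (F.P K) j`, events `histEvent θ K n Q`, `histGood = E_∅`) expands the full density as `Σ_Q heightDensity E_Q` a.e.
(✓`heightDensity_eq_sum_histories_ae`, [Balaban1985UV3] (41)'s «Σ_{{Ω_j}}»).  Print's first move in (40)–(41) p.266 is that ON THE SUPPORT OF `χ_k` the level-`k` large-field
set is EMPTY: a history with a large plaquette AT the comparison height carries no mass on the window.  THIS FILE types that move on the tree's objects: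

* §1 `heightDensity_ae_eq_zero_on_window_of_large` — an event all of whose fine fields have a `θ(n)`-LARGE plaquette at tower level `K − n` has height-`n` density `0` a.e. ON
  `W_n` (lit ✓`T3CruxEstimates.resDensity_ae_eq_zero_off` + ✓`plaqSmall_fieldShift`); `heightDensity_ae_eq_inter_smallTop_on_window` — hence EVERY event may be cut to its part
  that is small at level `K − n`: `heightDensity S = heightDensity (S ∩ T_n)` a.e. on `W_n`, `T_n := {U | PlaqSmall (θ n) (Ū^{K−n})}`; `histGood_eq_histGood_succ_inter` —
  `histGood θ K n = histGood θ K (n+1) ∩ T_n` (one more free top step differs exactly by the level-`K − n` clause), so `heightDensity (histGood K (n+1)) = heightDensity (histGood K n)`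
  a.e. on `W_n`.
* §2 `histEvent_subset_large_of_topLabel` ∕ `heightDensity_histEvent_ae_eq_zero_on_window` — a history `Q` containing a label at the comparison level `K − n` vanishes a.e. on `W_n`;
  ★`heightDensity_univ_ae_eq_sum_deep_on_window` — on `W_n` the full density is the sum over the DEEP histories (`∀ e ∈ Q, e.1 < K − n`) only; ★`heightDensity_univ_ae_eq_sum_succ`
  — equivalently (everywhere a.e., no window) the full height-`n` density is the sum over the histories of `LFLabel F K (n+1)` (levels `j ≤ K − n − 1`: `n + 1` free top steps), whose
  trivial term `heightDensity (histGood K (n+1))` IS LFG's all-small density on `W_n` by §1.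
* §3 `heightDensityCan_eqOn_window_of_ae` — the canonical reading: two events whose height densities agree a.e. on `W_n` have EQUAL canonical versions at every point of `W_n` as soon
  as one of them lies in the maximal regular set there (✓`Node00.canonVersion_eqOn_of_continuousOn`); applied: `heightDensityCan univ = heightDensityCan T_n`,
  `heightDensityCan (histGood K (n+1)) = heightDensityCan (histGood K n)` on `W_n` under the corresponding (r1)-rows.

WHAT IT BUYS (honest; CREDITS NOTHING): the hand on LFG^{can}∘ expands `heightDensityCan … univ ∕ heightDensityCan … histGood` on the window as `1 + Σ_{Q′ ≠ ∅}` over the histories with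
`n + 1` free top steps — the deep histories only; the content (the 𝐑-operation on each deep history: small-field expansion with holes, small factors, resummation) is NOT touched.
LFG∕LFRᶜ∕LFR♯ᶜ∘∕S2β, the crux 20520, EX∕19200, 19936 NOT proved; `YM3TorusSU2` NOT proved; the Yang–Mills mass gap (Clay) NOT proved; rung R3 = YM₃ on `T³` — NOT `d = 4`, NOT
infinite volume, NOT a mass gap.
References: [Balaban1985UV3] T. Bałaban, CMP 102 (1985) 255–275: (2) p.256, (7) p.257, (40)–(41) p.266; [Balaban1987RG1] CMP 109 (1987) (0.11) p.253, (0.13) p.254, (0.18) p.255.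
-/

set_option autoImplicit false

noncomputable section

open MeasureTheory Filter Topology Set
open scoped ENNReal
open Literature.MathematicalPhysics.QuantumFieldTheory.Balaban1983to89
open Literature.MathematicalPhysics.QuantumFieldTheory.Balaban1983to89.T3ContinuumYM3Torus
open Literature.MathematicalPhysics.QuantumFieldTheory.Balaban1983to89.T3LevelShift
open Literature.MathematicalPhysics.QuantumFieldTheory.Balaban1983to89.T3NestedUnitLaws
open Literature.MathematicalPhysics.QuantumFieldTheory.Balaban1983to89.T3UnitLawDensityEML
open Literature.MathematicalPhysics.QuantumFieldTheory.Balaban1983to89.T3UnitScaleTilt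
open Literature.MathematicalPhysics.QuantumFieldTheory.Balaban1983to89.T3RestrictedUnitDensity
open Literature.MathematicalPhysics.QuantumFieldTheory.Balaban1983to89.T3TiltDescent
open Literature.MathematicalPhysics.QuantumFieldTheory.Balaban1983to89.T3CruxEstimates
open Literature.MathematicalPhysics.QuantumFieldTheory.Balaban1983to89.T3PrintedRegularMinimiser
open Literature.MathematicalPhysics.QuantumFieldTheory.Balaban1983to89.Missing
open Literature.MathematicalPhysics.QuantumFieldTheory.Balaban1983to89.T4Continuum
open scoped Literature.MathematicalPhysics.QuantumFieldTheory.Balaban1983to89.T3OrbitAverage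
open Summit.QuantumFields.YangMills.Theorems.FluctuationComparisonRegPrIntLWregGlue (heightDensityCan)
open Summit.QuantumFields.YangMills.Theorems.FluctuationComparisonRegPrIntLRestrictedDensityAdditivity
open Summit.QuantumFields.YangMills.Theorems.FluctuationComparisonRegPrIntLHistoryPartition

namespace Summit.QuantumFields.YangMills.Theorems.FluctuationComparisonRegPrIntLLargeFieldGasWindowCut

variable {F : T3Family} {γ : ℝ} {K n : ℕ}

/-! ## §1 Events large at the comparison height vanish on the window; every event may be cut to its small-top part there -/

section Cut

/-- **LARGE AT THE COMPARISON HEIGHT ⇒ NO MASS ON THE WINDOW**: if every fine field of the (measurable) event `S` has SOME `θ(n)`-large plaquette of its `(K − n)`-fold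
average, then `heightDensity F γ hK S = 0` `dU_n`-a.e. on `W_n = {PlaqSmall (θ n)}` (the push-forward of `1_S·e^{−β_K A} dU` under `D_{n,K}` gives `W_n` zero mass).
[cite: Balaban1985UV3, (40) p.266 and (7) p.257] -/
theorem heightDensity_ae_eq_zero_on_window_of_large (hγ : 0 ≤ γ) (hK : n ≤ K) (θ : ℕ → ℝ)
    {S : Set (GaugeField (F.P K) 0 (Matrix.specialUnitaryGroup (Fin 2) ℂ))} (hS : MeasurableSet S)
    (hlarge : ∀ U ∈ S, ¬ PlaqSmall (θ n) (Averaging.iter (fun i => BlockAveraging.blockAvg (P := F.P K) (j := i) ℰp) (K - n) U)) :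
    ∀ᵐ V ∂fieldMeasure (F.P n) 0 (Matrix.specialUnitaryGroup (Fin 2) ℂ), PlaqSmall (θ n) V → heightDensity F γ hK S V = 0 := by
  let E : Set (GaugeField (F.P K) (K - n) (Matrix.specialUnitaryGroup (Fin 2) ℂ)) := {W | ¬ PlaqSmall (θ n) W}
  have hE : MeasurableSet E := (measurableSet_plaqSmall _).compl
  have hSE : ∀ U ∈ S, Averaging.iter (fun i => BlockAveraging.blockAvg (P := F.P K) (j := i) ℰp) (K - n) U ∈ E := hlarge
  have hae := resDensity_ae_eq_zero_off F hγ K hS (k := K - n) (by omega) hE hSE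
  have hmp := measurePreserving_fieldShift (G := Matrix.specialUnitaryGroup (Fin 2) ℂ)
    (F.sitesPerDir_eq (m := F.m) (K := K) (j := K - n) (m' := F.m) (K' := n) (j' := 0) (by omega))
  filter_upwards [hmp.quasiMeasurePreserving.ae hae] with V hV hsmall
  exact hV fun hmem => hmem ((plaqSmall_fieldShift F _ (θ n) V).mpr hsmall)

/-- The complement of the small-top event `T_n = {U | PlaqSmall (θ n) (Ū^{K−n})}` inside ANY event vanishes on the window. [cite: Balaban1985UV3, (40) p.266] -/
theorem heightDensity_inter_compl_smallTop_ae_eq_zero_on_window (hγ : 0 ≤ γ) (hK : n ≤ K) (θ : ℕ → ℝ)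
    {S : Set (GaugeField (F.P K) 0 (Matrix.specialUnitaryGroup (Fin 2) ℂ))} (hS : MeasurableSet S) :
    ∀ᵐ V ∂fieldMeasure (F.P n) 0 (Matrix.specialUnitaryGroup (Fin 2) ℂ), PlaqSmall (θ n) V →
      heightDensity F γ hK (S ∩ {U | PlaqSmall (θ n)
        (Averaging.iter (fun i => BlockAveraging.blockAvg (P := F.P K) (j := i) ℰp) (K - n) U)}ᶜ) V = 0 :=
  heightDensity_ae_eq_zero_on_window_of_large hγ hK θ
    (hS.inter ((measurableSet_plaqSmall _).preimage (measurable_iterAvg F K (K - n))).compl) (fun _ hU => hU.2)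

/-- **EVERY EVENT MAY BE CUT TO ITS SMALL-TOP PART ON THE WINDOW**: `heightDensity S = heightDensity (S ∩ T_n)` `dU_n`-a.e. on `W_n` (a.e. additivity
✓`resDensity_union_ae` over `S = (S ∩ T_n) ∪ (S ∩ T_nᶜ)` and the previous lemma). [cite: Balaban1985UV3, (40)-(41) p.266] -/
theorem heightDensity_ae_eq_inter_smallTop_on_window (hγ : 0 ≤ γ) (hK : n ≤ K) (θ : ℕ → ℝ)
    {S : Set (GaugeField (F.P K) 0 (Matrix.specialUnitaryGroup (Fin 2) ℂ))} (hS : MeasurableSet S) :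
    ∀ᵐ V ∂fieldMeasure (F.P n) 0 (Matrix.specialUnitaryGroup (Fin 2) ℂ), PlaqSmall (θ n) V →
      heightDensity F γ hK S V = heightDensity F γ hK (S ∩ {U | PlaqSmall (θ n)
        (Averaging.iter (fun i => BlockAveraging.blockAvg (P := F.P K) (j := i) ℰp) (K - n) U)}) V := by
  set T : Set (GaugeField (F.P K) 0 (Matrix.specialUnitaryGroup (Fin 2) ℂ)) :=
    {U | PlaqSmall (θ n) (Averaging.iter (fun i => BlockAveraging.blockAvg (P := F.P K) (j := i) ℰp) (K - n) U)} with hT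
  have hTm : MeasurableSet T := (measurableSet_plaqSmall _).preimage (measurable_iterAvg F K (K - n))
  have hsplit := resDensity_union_ae (F := F) (γ := γ) (K := K) (hS.inter hTm) (hS.inter hTm.compl)
    (Set.disjoint_left.mpr fun U hU hU' => hU'.2 hU.2) hγ (k := K - n) (by omega)
  rw [Set.inter_union_compl] at hsplit
  have hmp := measurePreserving_fieldShift (G := Matrix.specialUnitaryGroup (Fin 2) ℂ)
    (F.sitesPerDir_eq (m := F.m) (K := K) (j := K - n) (m' := F.m) (K' := n) (j' := 0) (by omega))
  filter_upwards [hmp.quasiMeasurePreserving.ae hsplit, heightDensity_inter_compl_smallTop_ae_eq_zero_on_window (F := F) (γ := γ) hγ hK θ hS]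
    with V hV hzero hsmall
  have hV' : heightDensity F γ hK S V = heightDensity F γ hK (S ∩ T) V + heightDensity F γ hK (S ∩ Tᶜ) V := hV
  rw [hV', hzero hsmall, add_zero]

/-- **ONE MORE FREE TOP STEP DIFFERS EXACTLY BY THE COMPARISON-LEVEL CLAUSE**: `histGood θ K n = histGood θ K (n+1) ∩ T_n`. [cite: Balaban1985UV3, (7) p.257] -/
theorem histGood_eq_histGood_succ_inter (hK : n ≤ K) (θ : ℕ → ℝ) :
    histGood F ℰp θ K n = histGood F ℰp θ K (n + 1) ∩ {U : GaugeField (F.P K) 0 (Matrix.specialUnitaryGroup (Fin 2) ℂ) | PlaqSmall (θ n)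
      (Averaging.iter (fun i => BlockAveraging.blockAvg (P := F.P K) (j := i) ℰp) (K - n) U)} := by
  ext U
  simp only [histGood, mem_setOf_eq, mem_inter_iff]
  constructor
  · intro h
    refine ⟨fun j hj => h j (by omega), ?_⟩
    have h' := h (K - n) (by omega)
    rwa [show K - (K - n) = n by omega] at h'
  · rintro ⟨h, htop⟩ j hj
    by_cases hj' : j + (n + 1) ≤ K
    · exact h j hj'
    · have hjK : j = K - n := by omega
      subst hjK
      rwa [show K - (K - n) = n by omega]

/-- **ON THE WINDOW THE ALL-SMALL DENSITIES WITH `n` AND WITH `n + 1` FREE TOP STEPS AGREE**: `heightDensity (histGood K (n+1)) = heightDensity (histGood K n)` `dU_n`-a.e. on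
`W_n`. [cite: Balaban1985UV3, (7) p.257 and (40) p.266] -/
theorem heightDensity_histGood_succ_ae_eq_on_window (hγ : 0 ≤ γ) (hK : n ≤ K) (θ : ℕ → ℝ) :
    ∀ᵐ V ∂fieldMeasure (F.P n) 0 (Matrix.specialUnitaryGroup (Fin 2) ℂ), PlaqSmall (θ n) V →
      heightDensity F γ hK (histGood F ℰp θ K (n + 1)) V = heightDensity F γ hK (histGood F ℰp θ K n) V := by
  filter_upwards [heightDensity_ae_eq_inter_smallTop_on_window (F := F) (γ := γ) hγ hK θ
    (measurableSet_histGood F ℰp measurableE_ℰp θ K (n + 1))] with V hV hsmall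
  rw [hV hsmall, ← histGood_eq_histGood_succ_inter hK θ]

end Cut

/-! ## §2 Histories with a label at the comparison level vanish on the window; the full density there is the sum over the deep histories -/

section Deep

/-- A history `Q` containing a label AT the comparison level `K − n` lies in the large-top event: its fields have a `θ(n)`-large plaquette of `Ū^{K−n}`.
[cite: Balaban1985UV3, (7) p.257 and (40) p.266] -/
theorem histEvent_subset_large_of_topLabel (hK : n ≤ K) (θ : ℕ → ℝ) {Q : Finset (LFLabel F K n)} {e : LFLabel F K n} (he : e ∈ Q)
    (htop : e.1.val = K - n) :
    ∀ U ∈ histEvent F θ K n Q,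
      ¬ PlaqSmall (θ n) (Averaging.iter (fun i => BlockAveraging.blockAvg (P := F.P K) (j := i) ℰp) (K - n) U) := by
  intro U hU hsmall
  obtain ⟨⟨j, hj⟩, p⟩ := e
  simp only at htop
  subst htop
  have hlarge : IsLarge F θ K n U ⟨⟨K - n, hj⟩, p⟩ := (hU _).mp he
  simp only [IsLarge] at hlarge
  rw [show K - (K - n) = n by omega] at hlarge
  exact absurd (hsmall p) (not_lt.mpr hlarge)

/-- **A HISTORY WITH A COMPARISON-LEVEL LABEL HAS NO MASS ON THE WINDOW**: `heightDensity (histEvent θ K n Q) = 0` `dU_n`-a.e. on `W_n`.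
[cite: Balaban1985UV3, (40) p.266] -/
theorem heightDensity_histEvent_ae_eq_zero_on_window (hγ : 0 ≤ γ) (hK : n ≤ K) (θ : ℕ → ℝ) {Q : Finset (LFLabel F K n)}
    (hQ : ∃ e ∈ Q, e.1.val = K - n) :
    ∀ᵐ V ∂fieldMeasure (F.P n) 0 (Matrix.specialUnitaryGroup (Fin 2) ℂ), PlaqSmall (θ n) V →
      heightDensity F γ hK (histEvent F θ K n Q) V = 0 := by
  obtain ⟨e, he, htop⟩ := hQ
  exact heightDensity_ae_eq_zero_on_window_of_large hγ hK θ (measurableSet_histEvent θ K n Q)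
    (histEvent_subset_large_of_topLabel hK θ he htop)

/-- ★ **ON THE WINDOW THE FULL DENSITY IS THE SUM OVER THE DEEP HISTORIES** (labels strictly below the comparison level): `heightDensity univ = Σ_{Q deep} heightDensity E_Q`
`dU_n`-a.e. on `W_n` (✓`heightDensity_eq_sum_histories_ae` minus the top-labelled histories). [cite: Balaban1985UV3, (40)-(41) p.266] -/
theorem heightDensity_univ_ae_eq_sum_deep_on_window (hγ : 0 ≤ γ) (hK : n ≤ K) (θ : ℕ → ℝ) :
    ∀ᵐ V ∂fieldMeasure (F.P n) 0 (Matrix.specialUnitaryGroup (Fin 2) ℂ), PlaqSmall (θ n) V →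
      heightDensity F γ hK Set.univ V =
        ∑ Q ∈ Finset.univ.filter (fun Q : Finset (LFLabel F K n) => ∀ e ∈ Q, e.1.val < K - n),
          heightDensity F γ hK (histEvent F θ K n Q) V := by
  classical
  have hzero : ∀ᵐ V ∂fieldMeasure (F.P n) 0 (Matrix.specialUnitaryGroup (Fin 2) ℂ), ∀ Q : Finset (LFLabel F K n),
      ¬ (∀ e ∈ Q, e.1.val < K - n) → PlaqSmall (θ n) V → heightDensity F γ hK (histEvent F θ K n Q) V = 0 := by
    refine ae_all_iff.mpr fun Q => ?_
    by_cases hdeep : ∀ e ∈ Q, e.1.val < K - n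
    · exact Eventually.of_forall fun V h => absurd hdeep h
    · obtain ⟨e, he, hge⟩ : ∃ e ∈ Q, ¬ (e.1.val < K - n) := by
        by_contra hcon
        exact hdeep fun e he => not_not.mp fun hlt => hcon ⟨e, he, hlt⟩
      have htop : e.1.val = K - n := by have := e.1.isLt; omega
      filter_upwards [heightDensity_histEvent_ae_eq_zero_on_window (F := F) (γ := γ) hγ hK θ ⟨e, he, htop⟩] with V hV
      exact fun _ => hV
  filter_upwards [heightDensity_eq_sum_histories_ae (F := F) (γ := γ) hK θ hγ, hzero] with V hsum hz hsmall
  rw [hsum, ← Finset.sum_filter_add_sum_filter_not Finset.univ (fun Q : Finset (LFLabel F K n) => ∀ e ∈ Q, e.1.val < K - n)]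
  have h0 : ∑ Q ∈ Finset.univ.filter (fun Q : Finset (LFLabel F K n) => ¬ ∀ e ∈ Q, e.1.val < K - n),
      heightDensity F γ hK (histEvent F θ K n Q) V = 0 :=
    Finset.sum_eq_zero fun Q hQ => hz Q (Finset.mem_filter.mp hQ).2 hsmall
  rw [h0, add_zero]

/-- ★ **THE HISTORIES WITH `n + 1` FREE TOP STEPS PARTITION EVERYTHING** (read at height `n`, everywhere a.e., no window): `heightDensity_n univ = Σ_{Q′ ⊆ LFLabel F K (n+1)}
heightDensity_n E^{(n+1)}_{Q′}` — the deep histories of height `n` ARE the histories of comparison height `n + 1`; the trivial term `Q′ = ∅` is `heightDensity_n (histGood K (n+1))`,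
which on `W_n` IS LFG's all-small density (§1). [cite: Balaban1985UV3, (7) p.257 and (41) p.266] -/
theorem heightDensity_univ_ae_eq_sum_succ (hγ : 0 ≤ γ) (hK : n ≤ K) (θ : ℕ → ℝ) :
    ∀ᵐ V ∂fieldMeasure (F.P n) 0 (Matrix.specialUnitaryGroup (Fin 2) ℂ),
      heightDensity F γ hK Set.univ V = ∑ Q' : Finset (LFLabel F K (n + 1)), heightDensity F γ hK (histEvent F θ K (n + 1) Q') V := by
  have h := heightDensity_biUnion_ae (F := F) (γ := γ) hK (Finset.univ : Finset (Finset (LFLabel F K (n + 1))))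
    (fun Q' => measurableSet_histEvent θ K (n + 1) Q') (fun Q' _ Q'' _ hne => histEvent_disjoint hne) hγ
  rw [iUnion_histEvent_eq_univ θ K (n + 1)] at h
  exact h

/-- The trivial term of the `n + 1` partition on the window: for `n + 1 ≤ K`, `heightDensity_n (histEvent θ K (n+1) ∅) = heightDensity_n (histGood K n)` a.e. on `W_n`.
[cite: Balaban1985UV3, (7) p.257 and (40) p.266] -/
theorem heightDensity_histEvent_empty_succ_ae_eq_on_window (hγ : 0 ≤ γ) (hK : n + 1 ≤ K) (θ : ℕ → ℝ) :
    ∀ᵐ V ∂fieldMeasure (F.P n) 0 (Matrix.specialUnitaryGroup (Fin 2) ℂ), PlaqSmall (θ n) V →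
      heightDensity F γ (Nat.le_of_succ_le hK) (histEvent F θ K (n + 1) ∅) V =
        heightDensity F γ (Nat.le_of_succ_le hK) (histGood F ℰp θ K n) V := by
  rw [← histGood_eq_histEvent_empty θ hK]
  exact heightDensity_histGood_succ_ae_eq_on_window hγ (Nat.le_of_succ_le hK) θ

end Deep

/-! ## §3 The canonical reading on the window -/

section Canonical

/-- **TWO EVENTS WHOSE HEIGHT DENSITIES AGREE A.E. ON THE WINDOW HAVE EQUAL CANONICAL VERSIONS THERE**, pointwise, as soon as the window lies in the maximal regular set of one of
them (✓`Node00.canonVersion_eqOn_of_continuousOn`: the continuous canonical version of the first is then an a.e. version of the second on the open window).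
[cite: Balaban1987RG1, (0.13) p.254; Balaban1985UV3, (40) p.266] -/
theorem heightDensityCan_eqOn_window_of_ae (hK : n ≤ K) (δ : ℝ)
    {S S' : Set (GaugeField (F.P K) 0 (Matrix.specialUnitaryGroup (Fin 2) ℂ))}
    (hae : ∀ᵐ V ∂fieldMeasure (F.P n) 0 (Matrix.specialUnitaryGroup (Fin 2) ℂ), PlaqSmall δ V → heightDensity F γ hK S V = heightDensity F γ hK S' V)
    (hR : {V : GaugeField (F.P n) 0 (Matrix.specialUnitaryGroup (Fin 2) ℂ) | PlaqSmall δ V} ⊆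
      Node00.regSet (fieldMeasure (F.P n) 0 (Matrix.specialUnitaryGroup (Fin 2) ℂ)) (heightDensity F γ hK S)) :
    EqOn (heightDensityCan F γ hK S') (heightDensityCan F γ hK S) {V : GaugeField (F.P n) 0 (Matrix.specialUnitaryGroup (Fin 2) ℂ) | PlaqSmall δ V} := by
  haveI := B12ContinuousTransportInvariance.isOpenPosMeasure_fieldMeasure_SU (N := 2) (F.P n) 0
  have hWo : IsOpen {V : GaugeField (F.P n) 0 (Matrix.specialUnitaryGroup (Fin 2) ℂ) | PlaqSmall δ V} := Node00.isOpen_plaqSmall _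
  have hc : ContinuousOn (heightDensityCan F γ hK S) {V | PlaqSmall δ V} := Node00.continuousOn_canonVersion.mono hR
  have h1 : heightDensityCan F γ hK S =ᵐ[(fieldMeasure (F.P n) 0 (Matrix.specialUnitaryGroup (Fin 2) ℂ)).restrict {V | PlaqSmall δ V}]
      heightDensity F γ hK S := ae_restrict_of_ae Node00.canonVersion_ae_eq
  have h2 : heightDensity F γ hK S =ᵐ[(fieldMeasure (F.P n) 0 (Matrix.specialUnitaryGroup (Fin 2) ℂ)).restrict {V | PlaqSmall δ V}]
      heightDensity F γ hK S' := by
    rw [Filter.EventuallyEq, ae_restrict_iff' hWo.measurableSet]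
    exact hae
  exact Node00.canonVersion_eqOn_of_continuousOn hWo hc (h1.trans h2)

/-- On the window, the canonical FULL density equals the canonical density of the small-top event `T_n` (under the (r1)-row of LFG^{can} for `univ`).
[cite: Balaban1985UV3, (40) p.266] -/
theorem heightDensityCan_univ_eqOn_smallTop (hγ : 0 ≤ γ) (hK : n ≤ K) (θ : ℕ → ℝ)
    (hR : {V : GaugeField (F.P n) 0 (Matrix.specialUnitaryGroup (Fin 2) ℂ) | PlaqSmall (θ n) V} ⊆
      Node00.regSet (fieldMeasure (F.P n) 0 (Matrix.specialUnitaryGroup (Fin 2) ℂ)) (heightDensity F γ hK Set.univ)) :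
    EqOn (heightDensityCan F γ hK {U | PlaqSmall (θ n)
        (Averaging.iter (fun i => BlockAveraging.blockAvg (P := F.P K) (j := i) ℰp) (K - n) U)})
      (heightDensityCan F γ hK Set.univ) {V : GaugeField (F.P n) 0 (Matrix.specialUnitaryGroup (Fin 2) ℂ) | PlaqSmall (θ n) V} := by
  refine heightDensityCan_eqOn_window_of_ae hK (θ n) ?_ hR
  filter_upwards [heightDensity_ae_eq_inter_smallTop_on_window (F := F) (γ := γ) hγ hK θ MeasurableSet.univ] with V hV hsmall
  rw [hV hsmall, Set.univ_inter]

/-- On the window, the canonical ALL-SMALL densities with `n` and with `n + 1` free top steps agree (under the (r1)-row for `histGood K n`).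
[cite: Balaban1985UV3, (7) p.257 and (40) p.266] -/
theorem heightDensityCan_histGood_succ_eqOn (hγ : 0 ≤ γ) (hK : n ≤ K) (θ : ℕ → ℝ)
    (hR : {V : GaugeField (F.P n) 0 (Matrix.specialUnitaryGroup (Fin 2) ℂ) | PlaqSmall (θ n) V} ⊆
      Node00.regSet (fieldMeasure (F.P n) 0 (Matrix.specialUnitaryGroup (Fin 2) ℂ)) (heightDensity F γ hK (histGood F ℰp θ K n))) :
    EqOn (heightDensityCan F γ hK (histGood F ℰp θ K (n + 1))) (heightDensityCan F γ hK (histGood F ℰp θ K n))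
      {V : GaugeField (F.P n) 0 (Matrix.specialUnitaryGroup (Fin 2) ℂ) | PlaqSmall (θ n) V} := by
  refine heightDensityCan_eqOn_window_of_ae hK (θ n) ?_ hR
  filter_upwards [heightDensity_histGood_succ_ae_eq_on_window (F := F) (γ := γ) hγ hK θ] with V hV hsmall
  exact (hV hsmall).symm

end Canonical

end Summit.QuantumFields.YangMills.Theorems.FluctuationComparisonRegPrIntLLargeFieldGasWindowCut

end
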